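import Mathlib
import Summits.KontsevichZagierPeriods.KontsevichZagierPeriods.Theorems.SoloInformedHookLabels
import Summits.KontsevichZagierPeriods.KontsevichZagierPeriods.Theorems.SoloInformedHookTail
import HarnessLib
import HarnessLib.Audit

/-!
# SoloInformed — the placement sum and its divided-difference recursion (hook identities, F1c)

Solo programme `solo-KontsevichZagierPeriods-informed`, session s51 (PROGRAMME LIII).

Starting from a block labelling `β` (blocks `0,…,K`) and a position `pos ≤ K` (the block of the
last placed coordinate), the hanging coordinates `bs = [b_i, b_{i-1}, …]` are placed one at a
time: `b` is inserted after block `pos + s` (new state `(PlIns β b (pos+s), K+1, pos+s+1)`) or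
merged into block `pos + s` (new state `(PlMerge β b (pos+s), K, pos+s)`), `0 ≤ s ≤ K − pos`.
The PLACEMENT SUM `soloInformedHookSum w β K pos bs` adds the chain functions
`G(Q_0(w),…,Q_{K'}(w))` of all final labellings.  THE RECURSION (`soloInformed_hookSum_step`):
for a further unplaced coordinate `b`, with `A` the last placed coordinate (`β A = pos`),

  `HookSum(bs ++ [b])(w)·(1 − w_b) = HookSum(bs)(w) − w_b·HookSum(bs)(w | w_A ↦ w_A w_b)`,

i.e. the placement sum of one more coordinate is the divided difference of the previous one in
the direction of the previous coordinate — the `B`-integrand of one scale band step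
(`SoloInformedScaleDatum.scale`).  The proof is the tail identity
`soloInformed_hookTail_succ` list by list (base case) and induction along `bs`.  (The
enumeration of the final states and of their index words is the next file.)

References: M. Kaneko, S. Yamamoto, arXiv:1605.03117, Thm 4.1, Prop. 5.4; M. Hoffman, Pacific J.
Math. 152 (1992) §2; Kontsevich–Zagier 2001 §1.2 [KontsevichZagier2001].
-/

noncomputable section

open Literature.NumberTheory.Transcendental
open Literature.NumberTheory.Transcendental.KZ

namespace Summit.KontsevichZagierPeriods.KontsevichZagierPeriods.Theorems

/-! ## 1. List lemmas: `ins`/`merge` beyond a prefix, scaling a tail -/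

/-- `merge_{pos+s}(Y; L) = L.take pos ++ merge_s(Y; L.drop pos)`. -/
theorem soloInformed_mergeQ_add (Y : ℝ) : ∀ (L : List ℝ) (pos s : ℕ), pos ≤ L.length →
    soloInformedMergeQ Y L (pos + s) = L.take pos ++ soloInformedMergeQ Y (L.drop pos) s
  | L, 0, s, _ => by simp
  | [], pos + 1, s, h => by simp at h
  | q :: t, pos + 1, s, h => by
    rw [show pos + 1 + s = (pos + s) + 1 by omega, soloInformedMergeQ_cons_succ,
      soloInformed_mergeQ_add Y t pos s (by simpa using h)]
    rfl

/-- `ins_{pos+s+1}(Y; L) = L.take pos ++ ins_{s+1}^{(0)}(Y; L.drop pos)` (`pos < |L|`). -/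
theorem soloInformed_insQ_add (Y : ℝ) :
    ∀ (p : ℝ) (L : List ℝ) (pos s : ℕ), pos < L.length →
      soloInformedInsQ Y p L (pos + s + 1) =
        L.take pos ++ soloInformedInsQ Y 0 (L.drop pos) (s + 1)
  | p, [], pos, s, h => by simp at h
  | p, q :: t, 0, s, _ => by simp
  | p, q :: t, pos + 1, s, h => by
    rw [show pos + 1 + s + 1 = (pos + s + 1) + 1 by omega, soloInformedInsQ_cons_succ,
      soloInformed_insQ_add Y q t pos s (by simpa using h)]
    rfl

/-- Scaling the tail: `merge_pos(Y; L) = L.take pos ++ (L.drop pos)·Y`. -/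
theorem soloInformed_mergeQ_eq_take_append (Y : ℝ) (L : List ℝ) {pos : ℕ}
    (h : pos ≤ L.length) :
    soloInformedMergeQ Y L pos = L.take pos ++ (L.drop pos).map (· * Y) := by
  have := soloInformed_mergeQ_add Y L pos 0 h
  rwa [add_zero, soloInformedMergeQ_zero] at this

/-! ## 2. Scaling one coordinate of the point -/

section point

variable {N : ℕ} (β : Fin N → ℕ) (w : Fin N → ℝ) (A : Fin N) (Y : ℝ)

/-- `Q_t(w | w_A ↦ w_A·Y) = Q_t(w)·Y` if `β A ≤ t`, else `Q_t(w)`. -/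
theorem soloInformed_BP_update_mul (t : ℕ) :
    soloInformedBP β (Function.update w A (w A * Y)) t =
      if β A ≤ t then soloInformedBP β w t * Y else soloInformedBP β w t := by
  unfold soloInformedBP
  split_ifs with h
  · have hA : A ∈ Finset.univ.filter (fun l : Fin N => β l ≤ t) := by simpa using h
    rw [← Finset.mul_prod_erase _ _ hA, ← Finset.mul_prod_erase _ (fun l => w l) hA,
      Function.update_self,
      Finset.prod_congr rfl fun l hl => Function.update_of_ne (Finset.ne_of_mem_erase hl) _ _]
    ring
  · exact Finset.prod_congr rfl fun l hl => Function.update_of_ne (by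
      rintro rfl
      simp only [Finset.mem_filter, Finset.mem_univ, true_and] at hl
      exact h hl) _ _

variable {β A} {K pos : ℕ} (hA : β A = pos)
include hA

/-- **The chain at the scaled point is `merge_pos(Y; Q)`** (the tail from block `pos = β A` on is
multiplied by `Y`). -/
theorem soloInformed_ofFn_BP_update :
    List.ofFn (fun t : Fin (K + 1) => soloInformedBP β (Function.update w A (w A * Y)) t) =
      soloInformedMergeQ Y (List.ofFn fun t : Fin (K + 1) => soloInformedBP β w t) pos := by
  apply List.ext_getElem?
  intro r
  rw [List.getElem?_ofFn, soloInformed_getElem?_mergeQ, List.getElem?_ofFn]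
  by_cases hr : r < K + 1
  · rw [dif_pos hr, dif_pos hr, soloInformed_BP_update_mul]
    by_cases h1 : r < pos
    · rw [if_neg (by show ¬β A ≤ r; omega), if_pos h1]
    · rw [if_pos (by show β A ≤ r; omega), if_neg h1]
      rfl
  · rw [dif_neg hr, dif_neg hr]
    split_ifs <;> rfl

end point

/-! ## 3. The placement sum -/

section hooksum

variable {N : ℕ} (w : Fin N → ℝ)

/-- **The placement sum.** Place the coordinates `bs` in order, starting from the labelling
`β` with blocks `0,…,K` and last position `pos`; add up the chain functions of the final
labellings. -/
def soloInformedHookSum : (Fin N → ℕ) → ℕ → ℕ → List (Fin N) → ℝ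
  | β, K, _, [] => soloInformedGQ (List.ofFn fun t : Fin (K + 1) => soloInformedBP β w t)
  | β, K, pos, b :: bs =>
      ∑ s ∈ Finset.range (K + 1 - pos),
        (soloInformedHookSum (soloInformedPlIns β b (pos + s)) (K + 1) (pos + s + 1) bs +
          soloInformedHookSum (soloInformedPlMerge β b (pos + s)) K (pos + s) bs)

/-- No coordinate left: the chain function of `β`. -/
@[simp] theorem soloInformedHookSum_nil (β : Fin N → ℕ) (K pos : ℕ) :
    soloInformedHookSum w β K pos [] =
      soloInformedGQ (List.ofFn fun t : Fin (K + 1) => soloInformedBP β w t) := rfl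

/-- One more coordinate: insert after / merge into block `pos + s`, `s ≤ K − pos`. -/
theorem soloInformedHookSum_cons (β : Fin N → ℕ) (K pos : ℕ) (b : Fin N)
    (bs : List (Fin N)) :
    soloInformedHookSum w β K pos (b :: bs) =
      ∑ s ∈ Finset.range (K + 1 - pos),
        (soloInformedHookSum w (soloInformedPlIns β b (pos + s)) (K + 1) (pos + s + 1) bs +
          soloInformedHookSum w (soloInformedPlMerge β b (pos + s)) K (pos + s) bs) := rfl

/-- The last placed coordinate: `lastD a [] = a`, `lastD a (c :: bs) = lastD c bs`. -/
def soloInformedLastD : Fin N → List (Fin N) → Fin N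
  | a, [] => a
  | _, c :: bs => soloInformedLastD c bs

/-- Nothing placed after `a`: the last placed coordinate is `a`. -/
@[simp] theorem soloInformedLastD_nil (a : Fin N) : soloInformedLastD a [] = a := rfl

/-- After placing `c :: bs` the last placed coordinate is `lastD c bs`. -/
@[simp] theorem soloInformedLastD_cons (a c : Fin N) (bs : List (Fin N)) :
    soloInformedLastD a (c :: bs) = soloInformedLastD c bs := rfl

variable {w} (hw : ∀ l, 0 < w l ∧ w l < 1)
include hw

/-- On the open cube the chain products of a labelling with a nonempty block `0` lie in
`(0,1)`. -/
theorem soloInformed_BP_mem_Ioo_of_fib {β : Fin N → ℕ} (h0 : 1 ≤ soloInformedFib β 0)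
    (t : ℕ) :
    0 < soloInformedBP β w t ∧ soloInformedBP β w t < 1 := by
  have h0' : 0 < (Finset.univ.filter fun l : Fin N => β l = 0).card := h0
  obtain ⟨l₀, hl₀⟩ := Finset.card_pos.1 h0'
  simp only [Finset.mem_filter, Finset.mem_univ, true_and] at hl₀
  unfold soloInformedBP
  have hmem : l₀ ∈ Finset.univ.filter (fun l : Fin N => β l ≤ t) := by simp [hl₀]
  refine ⟨Finset.prod_pos fun l _ => (hw l).1, ?_⟩
  rw [← Finset.mul_prod_erase _ _ hmem]
  calc w l₀ * ∏ x ∈ (Finset.univ.filter (fun l : Fin N => β l ≤ t)).erase l₀, w x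
      ≤ w l₀ * 1 := mul_le_mul_of_nonneg_left
        (Finset.prod_le_one (fun l _ => (hw l).1.le) fun l _ => (hw l).2.le) (hw l₀).1.le
    _ < 1 := by rw [mul_one]; exact (hw l₀).2

/-- **Base case: placing ONE coordinate is the divided difference of the chain function.**
For `β A = pos ≤ K` and `b` unplaced:
`HookSum([b])(w)·(1 − w_b) = G(Q(w)) − w_b·G(Q(w | w_A ↦ w_A w_b))`
[`soloInformed_hookTail_succ`]. -/
theorem soloInformed_hookSum_single {β : Fin N → ℕ} {K pos : ℕ} {A b : Fin N}
    (hL : soloInformedIsLabK β K) (hpos : pos ≤ K) (hA : β A = pos) (hb : K < β b) :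
    soloInformedHookSum w β K pos [b] * (1 - w b) =
      soloInformedGQ (List.ofFn fun t : Fin (K + 1) => soloInformedBP β w t) -
        w b * soloInformedGQ (List.ofFn fun t : Fin (K + 1) =>
          soloInformedBP β (Function.update w A (w A * w b)) t) := by
  have hYI : 0 ≤ w b ∧ w b < 1 := ⟨(hw b).1.le, (hw b).2⟩
  rw [soloInformed_ofFn_BP_update w (w b) hA]
  set Y := w b with hY
  set L := List.ofFn (fun t : Fin (K + 1) => soloInformedBP β w t) with hLdef
  have hlen : L.length = K + 1 := by simp [hLdef]
  have hTlen : (L.drop pos).length = K + 1 - pos := by rw [List.length_drop, hlen]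
  have hT : L.drop pos ≠ [] := by
    intro h
    have := congrArg List.length h
    rw [hTlen, List.length_nil] at this
    omega
  have hBP := soloInformed_BP_mem_Ioo_of_fib hw (β := β) (le_trans (by norm_num) hL.2)
  have hL' : ∀ q ∈ L, 0 ≤ q ∧ q < 1 := by
    intro q hq
    rw [hLdef, List.mem_ofFn] at hq
    obtain ⟨t, rfl⟩ := hq
    exact ⟨(hBP t).1.le, (hBP t).2⟩
  have hT' : ∀ q ∈ L.drop pos, 0 ≤ q ∧ q < 1 := fun q hq => hL' q (List.drop_subset _ _ hq)
  have key := soloInformed_hookTail_succ hYI (L.take pos) hT hT'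
  rw [List.take_append_drop, hTlen] at key
  rw [soloInformed_mergeQ_eq_take_append Y L (by omega : pos ≤ L.length),
    soloInformedHookSum_cons]
  have e : ∀ s ∈ Finset.range (K + 1 - pos),
      soloInformedHookSum w (soloInformedPlIns β b (pos + s)) (K + 1) (pos + s + 1) [] +
        soloInformedHookSum w (soloInformedPlMerge β b (pos + s)) K (pos + s) [] =
      soloInformedGQ (L.take pos ++ soloInformedInsQ Y 0 (L.drop pos) (s + 1)) +
        soloInformedGQ (L.take pos ++ soloInformedMergeQ Y (L.drop pos) s) := by
    intro s hs
    have hs' : pos + s ≤ K := by rw [Finset.mem_range] at hs; omega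
    rw [soloInformedHookSum_nil, soloInformedHookSum_nil,
      soloInformed_ofFn_BP_plIns hb hs' w 0, soloInformed_ofFn_BP_plMerge hb w,
      soloInformed_insQ_add Y 0 L pos s (by omega), soloInformed_mergeQ_add Y L pos s (by omega)]
  rw [Finset.sum_congr rfl e, Finset.sum_add_distrib, key]
  ring

/-- **THE RECURSION OF THE PLACEMENT SUM.** For a state `(β, K, pos)` with partial validity,
`pos ≤ K`, `β a = pos`, and pairwise distinct unplaced coordinates `bs ++ [b]`:

  `HookSum(bs ++ [b])(w)·(1 − w_b) = HookSum(bs)(w) − w_b·HookSum(bs)(w | w_A ↦ w_A·w_b)`,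

`A = lastD a bs` the coordinate placed last before `b`. -/
theorem soloInformed_hookSum_step {b : Fin N} :
    ∀ (bs : List (Fin N)) (β : Fin N → ℕ) (K pos : ℕ) (a : Fin N),
      soloInformedIsLabK β K → pos ≤ K → β a = pos → (∀ x ∈ bs ++ [b], K < β x) →
      (bs ++ [b]).Nodup →
    soloInformedHookSum w β K pos (bs ++ [b]) * (1 - w b) =
      soloInformedHookSum w β K pos bs -
        w b * soloInformedHookSum (Function.update w (soloInformedLastD a bs)
          (w (soloInformedLastD a bs) * w b)) β K pos bs
  | [], β, K, pos, a, hL, hpos, hA, hub, _ => by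
    rw [List.nil_append, soloInformedHookSum_nil, soloInformedHookSum_nil, soloInformedLastD_nil]
    exact soloInformed_hookSum_single hw hL hpos hA (hub b (by simp))
  | c :: bs, β, K, pos, a, hL, hpos, hA, hub, hnd => by
    have hnd' : (c :: (bs ++ [b])).Nodup := hnd
    have hcn : c ∉ bs ++ [b] := (List.nodup_cons.1 hnd').1
    have hnd2 : (bs ++ [b]).Nodup := (List.nodup_cons.1 hnd').2
    have hcK : K < β c := hub c (by simp)
    have hrest : ∀ x ∈ bs ++ [b], x ≠ c ∧ K < β x := fun x hx =>
      ⟨fun h => hcn (h ▸ hx), hub x (List.mem_cons_of_mem c hx)⟩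
    rw [List.cons_append, soloInformedHookSum_cons, soloInformedHookSum_cons,
      soloInformedHookSum_cons, soloInformedLastD_cons, Finset.sum_mul, Finset.mul_sum,
      ← Finset.sum_sub_distrib]
    refine Finset.sum_congr rfl fun s hs => ?_
    have hs' : pos + s ≤ K := by rw [Finset.mem_range] at hs; omega
    have IH1 := soloInformed_hookSum_step bs (soloInformedPlIns β c (pos + s)) (K + 1)
      (pos + s + 1) c (soloInformed_isLabK_plIns hcK hL hs') (by omega)
      (soloInformedPlIns_self β c (pos + s))
      (fun x hx => soloInformed_lt_plIns_of_ne hs' (hrest x hx).1 (hrest x hx).2) hnd2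
    have IH2 := soloInformed_hookSum_step bs (soloInformedPlMerge β c (pos + s)) K (pos + s) c
      (soloInformed_isLabK_plMerge hcK hL) hs' (soloInformedPlMerge_self β c (pos + s))
      (fun x hx => soloInformed_lt_plMerge_of_ne (hrest x hx).1 (hrest x hx).2) hnd2
    rw [add_mul, IH1, IH2]
    ring

end hooksum


end Summit.KontsevichZagierPeriods.KontsevichZagierPeriods.Theorems
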